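import Literature.Geometry.Riemannian.GeodesicPolarCoordinates
import HarnessLib

/-!
# The distribution of `d(p, ·)` under `Ric ≥ n - 1` is dominated by that of the round sphere

On a closed connected Riemannian `m`-manifold with `Ric ≥ (m-1) g`, `m ≥ 2`, the law of the
distance function `d_p = d(p, ·)` under the Riemannian measure is dominated by the law of the
distance to a point of the unit sphere `Sᵐ`, `|S^{m-1}| sin^{m-1}(r) dr` on `(0, π]`:

  `∫_M φ(d(p, x)) dVol(x) ≤ |S^{m-1}| ∫₀^π φ(r) sin^{m-1}(r) dr`   for every measurable `φ ≥ 0`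

(`lintegral_comp_edist_le_mul_lintegral_sin_pow`) — Bishop's comparison theorem
(`√det(g(d exp)) ≤ (sin|v|/|v|)^{m-1}` on the minimizing directions,
`sqrt_det_gram_mfderiv_expMap_mul_pow_le_of_unit`) integrated in geodesic polar coordinates about
`p` (`lintegral_riemVolume_eq_lintegral_injectivityDomain`: the cut locus is null and `exp_p` is
injective on the injectivity domain) with a radial weight. The case `φ = 𝟙_{[0, r]}` is Bishop's
`Vol B̄_r(p) ≤ V₁(r)` of `BishopVolumeComparison.lean`; here we also get the shells
`Vol{a < d_p ≤ b} ≤ |S^{m-1}| ∫_a^b sin^{m-1}` (`riemVolume_shell_le`), and, when the volume is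
almost maximal, `Vol(M) ≥ (1-δ)|Sᵐ|`, the matching LOWER bounds
`∫_M φ(d_p) ≥ |S^{m-1}| ∫₀^π φ sin^{m-1} - δ|Sᵐ|` for `φ ≤ 1`
(`mul_lintegral_sin_pow_le_lintegral_comp_edist_add`), i.e. the law of `d_p` is `δ|Sᵐ|`-close in
total variation to the spherical law — the volume estimates for distance spheres and annuli used
throughout Colding's proof of the volume sphere theorem (`Colding1996_volume_ghClose`; Colding,
Invent. Math. 124 (1996), §2: choice of points at pairwise distance `≈ π/2`, volumes of the sets
where the law of cosines is tested), stated also in the binders of the fact (§3).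

All results are proved; no definitions, no named facts (D-0026).

## References

* I. Chavel, *Riemannian Geometry: A Modern Introduction*, 2nd ed. (2006), Thm. III.4.3–III.4.4
  ((III.4.13), (III.4.21)) and §III.3 (geodesic polar coordinates). [Chavel2006]
* T. H. Colding, *Shape of manifolds with positive Ricci curvature*, Invent. Math. 124 (1996)
  175–191, §2. [Colding1996Shape]
* T. H. Colding, *Aspects of Ricci curvature*, in: Comparison Geometry, MSRI Publ. 30 (1997)
  83–98, Thm. 2.2 and its proof. [Colding1997Aspects]
-/

noncomputable section

open Bundle Set Function Filter MeasureTheory Manifold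
open scoped Manifold ContDiff Topology ENNReal NNReal

namespace Literature.Geometry.Riemannian

open Lorentzian Lorentzian.PseudoRiemannianMetric

section Main

variable {m : ℕ} {M : Type*} [TopologicalSpace M] [T2Space M] [SecondCountableTopology M]
  [ChartedSpace (EuclideanSpace ℝ (Fin m)) M] [IsManifold (𝓡 m) ∞ M] [T3Space M]
  [MeasurableSpace M] [BorelSpace M]
  (g : PseudoRiemannianMetric (𝓡 m) ∞ (EuclideanSpace ℝ (Fin m)) (TangentSpace (𝓡 m) : M → Type _))
  [ConnectedSpace M] [CompactSpace M] [g.HasLeviCivita]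

/-! ### §1 The radial model integral -/

omit [T2Space M] [SecondCountableTopology M] [IsManifold (𝓡 m) ∞ M] [T3Space M] [MeasurableSpace M]
  [BorelSpace M] [ConnectedSpace M] [CompactSpace M] [g.HasLeviCivita] in
/-- **The model integral in the tangent space**: for a measurable `φ : ℝ → [0, ∞]`,
`∫_{‖v‖ ≤ π} (sin ‖v‖/‖v‖)ᵏ φ(‖v‖) dv = |Sᵏ| ∫_{(0, π]} sinᵏ(r) φ(r) dr` on `ℝᵏ⁺¹` (polar
coordinates, `lintegral_fun_norm_addHaar`, `|Sᵏ| = (k+1) Vol B₁`). [cite: Chavel2006, (III.4.1)] -/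
theorem lintegral_closedBall_sin_div_pow_mul (k : ℕ) {φ : ℝ → ℝ≥0∞} (hφ : Measurable φ) :
    ∫⁻ v in Metric.closedBall (0 : EuclideanSpace ℝ (Fin (k + 1))) Real.pi,
        ENNReal.ofReal ((Real.sin ‖v‖ / ‖v‖) ^ k) * φ ‖v‖ =
      ENNReal.ofReal (unitSphereVolume k) *
        ∫⁻ r in Ioc (0:ℝ) Real.pi, ENNReal.ofReal (Real.sin r ^ k) * φ r := by
  set G : ℝ → ℝ≥0∞ := fun y ↦ ENNReal.ofReal ((Real.sin y / y) ^ k) * φ y with hG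
  have hGm : Measurable G := by
    rw [hG]
    exact (ENNReal.measurable_ofReal.comp (by fun_prop)).mul hφ
  set f : ℝ → ℝ≥0∞ := (Iic Real.pi).indicator G with hf_def
  have hf : Measurable f := hGm.indicator measurableSet_Iic
  have hL : ∫⁻ v in Metric.closedBall (0 : EuclideanSpace ℝ (Fin (k + 1))) Real.pi, G ‖v‖ =
      ∫⁻ v : EuclideanSpace ℝ (Fin (k + 1)), f ‖v‖ := by
    rw [← lintegral_indicator Metric.isClosed_closedBall.measurableSet]
    refine lintegral_congr fun v ↦ ?_
    simp only [hf_def, Set.indicator, Metric.mem_closedBall, dist_zero_right, mem_Iic]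
  rw [hL, Literature.Probability.Distributions.lintegral_fun_norm_addHaar volume f hf,
    finrank_euclideanSpace_fin]
  have hrad : ∫⁻ y in Ioi (0 : ℝ), ENNReal.ofReal (y ^ (k + 1 - 1)) * f y =
      ∫⁻ r in Ioc (0:ℝ) Real.pi, ENNReal.ofReal (Real.sin r ^ k) * φ r := by
    have h1 : ∀ y ∈ Ioi (0 : ℝ), ENNReal.ofReal (y ^ (k + 1 - 1)) * f y =
        (Iic Real.pi).indicator (fun y ↦ ENNReal.ofReal (Real.sin y ^ k) * φ y) y := by
      intro y hy
      have hy0 : (y : ℝ) ≠ 0 := (mem_Ioi.1 hy).ne'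
      by_cases hyr : y ≤ Real.pi
      · rw [hf_def, indicator_of_mem (mem_Iic.2 hyr), indicator_of_mem (mem_Iic.2 hyr), hG,
          Nat.add_sub_cancel, ← mul_assoc, ← ENNReal.ofReal_mul (pow_nonneg (mem_Ioi.1 hy).le k),
          ← mul_pow, mul_div_cancel₀ _ hy0]
      · rw [hf_def, indicator_of_notMem (fun h ↦ hyr (mem_Iic.1 h)),
          indicator_of_notMem (fun h ↦ hyr (mem_Iic.1 h)), mul_zero]
    rw [setLIntegral_congr_fun measurableSet_Ioi h1, setLIntegral_indicator measurableSet_Iic,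
      Set.Iic_inter_Ioi]
  rw [hrad, ofReal_unitSphereVolume_eq_mul_volume_ball]
  push_cast
  ring

/-! ### §2 Domination of the law of `d_p` by the spherical law -/
set_option maxHeartbeats 400000 in -- buildfix (bf3-g27): 160k/180k FAIL, 200k PASS at accept time; line-neutral budget line
/-- **The law of `d(p, ·)` is dominated by the spherical law `|S^{m-1}| sin^{m-1}(r) dr`**
(Bishop's comparison theorem in geodesic polar coordinates; Chavel 2006, Thm. III.4.3–4 with
§III.3). On a compact connected Riemannian `m`-manifold, `m ≥ 2`, with `Ric ≥ (m-1) g`, for every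
`p` and every measurable `φ : ℝ → [0, ∞]`,
  `∫_M φ(d(p, x)) dVol(x) ≤ |S^{m-1}| ∫_{(0,π]} sin^{m-1}(r) φ(r) dr`.
Proof: `∫_M G = ∫_{T⁻¹ID(p)} 𝒥 · G ∘ exp_p ∘ T` for an isometry `T : ℝᵐ → T_pM`
(`lintegral_riemVolume_eq_lintegral_injectivityDomain`); on `ID(p)`, `d(p, exp_p(Tv)) = ‖v‖ ≤ π`
(Myers) and `𝒥(v) ≤ (sin‖v‖/‖v‖)^{m-1}` (`sqrt_det_gram_mfderiv_expMap_mul_pow_le_of_unit`);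
then §1. [cite: Chavel2006, Thm. III.4.4 (III.4.21)] [cite: Colding1996Shape, §2] -/
theorem lintegral_comp_edist_le_mul_lintegral_sin_pow (hg : g.IsRiemannian) (hm : 2 ≤ m)
    (hRic : ∀ (x : M) (w : TangentSpace (𝓡 m) x), ((m : ℝ) - 1) * g.val x w w ≤ g.ricci x w w)
    (p : M) {φ : ℝ → ℝ≥0∞} (hφ : Measurable φ) :
    ∫⁻ x, φ (g.edist hg p x).toReal ∂g.riemVolume ≤
      ENNReal.ofReal (unitSphereVolume (m - 1)) *
        ∫⁻ r in Ioc (0:ℝ) Real.pi, ENNReal.ofReal (Real.sin r ^ (m - 1)) * φ r := by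
  obtain ⟨k, rfl⟩ : ∃ k, m = k + 1 := ⟨m - 1, by omega⟩
  rw [Nat.add_sub_cancel]
  -- §0 smoothness and completeness of the Levi-Civita connection
  have hk1' : ((1 : ℕ∞) : ℕ∞ω) + 1 ≤ ((⊤ : ℕ∞) : ℕ∞ω) := by
    rw [show ((1 : ℕ∞) : ℕ∞ω) + 1 = 2 by norm_num]
    exact WithTop.coe_le_coe.2 le_top
  haveI : CovariantDerivative.ContMDiffCovariantDerivative g.leviCivita 1 :=
    ⟨g.isLocallyContMDiff_leviCivita_holds 1 hk1' univ isOpen_univ⟩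
  haveI : CovariantDerivative.ContMDiffCovariantDerivative g.leviCivita ((⊤ : ℕ∞) : ℕ∞ω) :=
    ⟨g.isLocallyContMDiff_leviCivita_holds ⊤ (le_of_eq rfl) univ isOpen_univ⟩
  haveI : Fact (1 ≤ ((⊤ : ℕ∞) : ℕ∞ω)) := ⟨by exact_mod_cast le_top⟩
  have hcpl : ∀ (x : M) (r : ℝ≥0), IsCompact {y : M | g.edist hg x y ≤ r} :=
    isCompact_setOf_edist_le_of_compactSpace g hg
  have hc : IsGeodesicallyComplete g.leviCivita :=
    isGeodesicallyComplete_of_isCompact_closedBall hg hcpl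
  have hfinE : Module.finrank ℝ (EuclideanSpace ℝ (Fin (k + 1))) = k + 1 :=
    finrank_euclideanSpace_fin
  have hRic' : ∀ (x : M) (w : TangentSpace (𝓡 (k + 1)) x),
      ((Module.finrank ℝ (EuclideanSpace ℝ (Fin (k + 1))) : ℝ) - 1) * g.val x w w ≤
        g.leviCivita.ricci x w w := by
    intro x w
    rw [hfinE]
    exact hRic x w
  -- §1 a `g_p`-orthonormal basis `bx` of `T_pM = ℝᵐ` and the framing `T : ℝᵐ ≃ T_pM`,
  -- `T eᵢ = bxᵢ`, `|T v|_g = ‖v‖` (as in `riemVolume_closedBall_le_of_ricci_ge`)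
  obtain ⟨e₀, he₀⟩ := g.exists_orthonormal_basis p hg
  have hfin : Module.finrank ℝ (TangentSpace (𝓡 (k + 1)) p) = k + 1 := by
    show Module.finrank ℝ (EuclideanSpace ℝ (Fin (k + 1))) = k + 1
    exact hfinE
  set bx : Module.Basis (Fin (k + 1)) ℝ (EuclideanSpace ℝ (Fin (k + 1))) :=
    (e₀.reindex (finCongr hfin) : Module.Basis (Fin (k + 1)) ℝ (TangentSpace (𝓡 (k + 1)) p))
    with hbx_def
  have hbxi : ∀ i, bx i = e₀ ((finCongr hfin).symm i) := fun i ↦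
    e₀.reindex_apply (finCongr hfin) i
  have honx : ∀ i j, g.val p (bx i) (bx j) = if i = j then (1 : ℝ) else 0 := by
    intro i j
    rw [hbxi, hbxi, he₀]
    simp only [EmbeddingLike.apply_eq_iff_eq]
  have hgram1 : Real.sqrt (Matrix.of fun i j ↦ g.val p (bx i) (bx j)).det = 1 := by
    have h1 : (Matrix.of fun i j ↦ g.val p (bx i) (bx j)) = 1 := by
      ext i j
      rw [Matrix.of_apply, honx, Matrix.one_apply]
    rw [h1, Matrix.det_one, Real.sqrt_one]
  obtain ⟨T, hT_single', hT'⟩ := exists_framing_of_orthonormal (k + 1) (g.val p) bx honx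
  -- restated in the present elaboration context (`T_pM` versus `ℝᵐ`)
  have hT_single : ∀ i, T (EuclideanSpace.single i (1 : ℝ)) = bx i := fun i ↦ hT_single' i
  have hT : ∀ v : EuclideanSpace ℝ (Fin (k + 1)), g.val p (T v) (T v) = ‖v‖ ^ 2 := fun v ↦ hT' v
  have hT_norm : ∀ v, Real.sqrt (g.val p (T v) (T v)) = ‖v‖ := fun v ↦ by
    rw [hT v, Real.sqrt_sq (norm_nonneg _)]
  -- §2 `F = exp_p ∘ T` and its Gram–Jacobian
  set F : EuclideanSpace ℝ (Fin (k + 1)) → M := fun v ↦ riemannianExpMap g p (T v) with hF_def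
  have hexp : ContMDiff 𝓘(ℝ, EuclideanSpace ℝ (Fin (k + 1))) (𝓡 (k + 1)) 1
      (fun u : EuclideanSpace ℝ (Fin (k + 1)) ↦ riemannianExpMap g p u) :=
    (contMDiff_riemannianExpMap g le_rfl hc p).of_le (WithTop.coe_le_coe.mpr le_top)
  set J : EuclideanSpace ℝ (Fin (k + 1)) → ℝ := fun v ↦ Real.sqrt (Matrix.det (Matrix.of
    fun i j : Fin (k + 1) ↦ g.val (F v)
      (mfderiv 𝓘(ℝ, EuclideanSpace ℝ (Fin (k + 1))) (𝓡 (k + 1)) F v (EuclideanSpace.single i (1 : ℝ)))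
      (mfderiv 𝓘(ℝ, EuclideanSpace ℝ (Fin (k + 1))) (𝓡 (k + 1)) F v (EuclideanSpace.single j (1 : ℝ)))))
    with hJ_def
  have hchain : ∀ v i, mfderiv 𝓘(ℝ, EuclideanSpace ℝ (Fin (k + 1))) (𝓡 (k + 1)) F v
      (EuclideanSpace.single i (1 : ℝ)) =
      mfderiv 𝓘(ℝ, EuclideanSpace ℝ (Fin (k + 1))) (𝓡 (k + 1))
        (fun u : EuclideanSpace ℝ (Fin (k + 1)) ↦ riemannianExpMap g p u) (T v) (bx i) := by
    intro v i
    have h1 : HasMFDerivAt 𝓘(ℝ, EuclideanSpace ℝ (Fin (k + 1))) (𝓡 (k + 1))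
        (fun u : EuclideanSpace ℝ (Fin (k + 1)) ↦ riemannianExpMap g p u) (T v)
        (mfderiv 𝓘(ℝ, EuclideanSpace ℝ (Fin (k + 1))) (𝓡 (k + 1))
          (fun u : EuclideanSpace ℝ (Fin (k + 1)) ↦ riemannianExpMap g p u) (T v)) :=
      ((hexp (T v)).mdifferentiableAt one_ne_zero).hasMFDerivAt
    have h2 : HasMFDerivAt 𝓘(ℝ, EuclideanSpace ℝ (Fin (k + 1))) (𝓡 (k + 1)) F v
        ((mfderiv 𝓘(ℝ, EuclideanSpace ℝ (Fin (k + 1))) (𝓡 (k + 1))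
          (fun u : EuclideanSpace ℝ (Fin (k + 1)) ↦ riemannianExpMap g p u) (T v)).comp
          (T : EuclideanSpace ℝ (Fin (k + 1)) →L[ℝ] EuclideanSpace ℝ (Fin (k + 1)))) :=
      h1.comp v (ContinuousLinearMap.hasMFDerivAt
        (f := (T : EuclideanSpace ℝ (Fin (k + 1)) →L[ℝ] EuclideanSpace ℝ (Fin (k + 1)))) (x := v))
    rw [h2.mfderiv, ContinuousLinearMap.comp_apply]
    exact congrArg _ (hT_single i)
  have hJexp : ∀ v, J v = Real.sqrt (Matrix.of fun i j ↦ g.val (expMap g.leviCivita p (T v))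
      (mfderiv 𝓘(ℝ, EuclideanSpace ℝ (Fin (k + 1))) 𝓘(ℝ, EuclideanSpace ℝ (Fin (k + 1)))
        (fun w : EuclideanSpace ℝ (Fin (k + 1)) ↦ expMap g.leviCivita p w) (T v) (bx i))
      (mfderiv 𝓘(ℝ, EuclideanSpace ℝ (Fin (k + 1))) 𝓘(ℝ, EuclideanSpace ℝ (Fin (k + 1)))
        (fun w : EuclideanSpace ℝ (Fin (k + 1)) ↦ expMap g.leviCivita p w) (T v) (bx j))).det := by
    intro v
    rw [hJ_def]
    simp only [hchain]
    rfl
  -- §3 Bishop's bound on the minimizing directions: `J(v) ≤ (sin ‖v‖/‖v‖)ᵏ`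
  have hJle : ∀ v : EuclideanSpace ℝ (Fin (k + 1)), v ≠ 0 →
      IsMinimizingUpTo g hg p (T v : TangentSpace (𝓡 (k + 1)) p) 1 →
      J v ≤ (Real.sin ‖v‖ / ‖v‖) ^ k := by
    intro v hv0 hmin
    set w : EuclideanSpace ℝ (Fin (k + 1)) := T v with hw_def
    set ℓ : ℝ := ‖v‖ with hℓ_def
    have hℓ : 0 < ℓ := norm_pos_iff.2 hv0
    have hwℓ : Real.sqrt (g.val p w w) = ℓ := hT_norm v
    set u : EuclideanSpace ℝ (Fin (k + 1)) := ℓ⁻¹ • w with hu_def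
    have hww : g.val p w w = ℓ ^ 2 := by rw [hw_def, hT v]
    have hu : g.val p u u = 1 := by
      have h1 : g.val p (ℓ⁻¹ • (show TangentSpace (𝓡 (k + 1)) p from w))
          (ℓ⁻¹ • (show TangentSpace (𝓡 (k + 1)) p from w)) = ℓ⁻¹ * (ℓ⁻¹ * g.val p w w) := by
        rw [map_smul, map_smul, FunLike.coe_smul, Pi.smul_apply]
        rfl
      have h2 : g.val p u u = ℓ⁻¹ * (ℓ⁻¹ * g.val p w w) := h1
      rw [h2, hww]
      field_simp
    have hminℓ : IsMinimizingUpTo g hg p u ℓ := by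
      have h := (isMinimizingUpTo_smul_iff hg hc p (show TangentSpace (𝓡 (k + 1)) p from w)
        (inv_pos.2 hℓ) ℓ).2
      rw [inv_mul_cancel₀ hℓ.ne'] at h
      exact h hmin
    have hℓu : ℓ • u = w := by rw [hu_def, smul_smul, mul_inv_cancel₀ hℓ.ne', one_smul]
    have key := sqrt_det_gram_mfderiv_expMap_mul_pow_le_of_unit g hg hc (by rw [hfinE]; omega)
      hRic' p u hu hℓ hminℓ bx (t := ℓ) ⟨hℓ, le_rfl⟩
    rw [hgram1, one_mul, hfinE, Nat.add_sub_cancel, hℓu] at key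
    rw [hJexp]
    exact ((le_div_iff₀ (pow_pos hℓ k)).2 key).trans_eq (div_pow _ _ _).symm
  -- §4 on `T⁻¹ ID(p)`: minimality, `d(p, F v) = ‖v‖ ≤ π`
  set D : Set (EuclideanSpace ℝ (Fin (k + 1))) :=
    {v | (T v : TangentSpace (𝓡 (k + 1)) p) ∈ injectivityDomain g hg p} with hD_def
  have hDmin : ∀ v ∈ D, IsMinimizingUpTo g hg p (T v : TangentSpace (𝓡 (k + 1)) p) 1 := by
    rintro v ⟨s, hs1, hs⟩
    exact hs.mono hc zero_le_one hs1.le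
  have hDdist : ∀ v ∈ D, g.edist hg p (F v) = ENNReal.ofReal ‖v‖ := fun v hv ↦ by
    rw [hF_def]
    simp only
    rw [edist_eq_of_isMinimizingUpTo hg hc (hDmin v hv), hT_norm]
  have hDπ : D ⊆ Metric.closedBall (0 : EuclideanSpace ℝ (Fin (k + 1))) Real.pi := by
    intro v hv
    rw [mem_closedBall_zero_iff]
    have h := edist_le_pi_div_sqrt_of_ricci_ge_of_compactSpace g hg (by rw [hfinE]; omega)
      one_pos (fun x w ↦ by rw [mul_one]; exact hRic' x w) p (F v)
    rw [Real.sqrt_one, div_one, hDdist v hv] at h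
    exact (ENNReal.ofReal_le_ofReal_iff Real.pi_pos.le).1 h
  -- §5 assembly
  have hGm : Measurable fun x : M ↦ φ (g.edist hg p x).toReal := by
    refine hφ.comp ?_
    have h1 : Continuous fun x : M ↦ g.edist hg p x :=
      (PseudoRiemannianMetric.continuous_edist hg).comp (Continuous.prodMk_right p)
    exact (ENNReal.measurable_toReal.comp h1.measurable)
  have hpolar := lintegral_riemVolume_eq_lintegral_injectivityDomain g hg (by omega) hcpl p T hT hGm
  rw [hpolar]
  have hD_core := injectivityDomain_framing_core g hg (by omega) hcpl p T hT
  have hDm : MeasurableSet D := hD_core.1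
  -- pointwise on `D ∖ {0}`: `J(v) φ(d(p, F v)) ≤ (sin‖v‖/‖v‖)ᵏ φ(‖v‖)`
  have hae : ∀ᵐ v ∂(volume : Measure (EuclideanSpace ℝ (Fin (k + 1)))), v ∈ D →
      ENNReal.ofReal (J v) * φ (g.edist hg p (F v)).toReal ≤
        ENNReal.ofReal ((Real.sin ‖v‖ / ‖v‖) ^ k) * φ ‖v‖ := by
    have h0 : ∀ᵐ v ∂(volume : Measure (EuclideanSpace ℝ (Fin (k + 1)))),
        v ∉ ({0} : Set (EuclideanSpace ℝ (Fin (k + 1)))) :=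
      measure_eq_zero_iff_ae_notMem.1 (measure_singleton 0)
    filter_upwards [h0] with v hv hvD
    rw [hDdist v hvD, ENNReal.toReal_ofReal (norm_nonneg _)]
    exact mul_le_mul_left (ENNReal.ofReal_le_ofReal (hJle v hv (hDmin v hvD))) _
  calc ∫⁻ v in D, ENNReal.ofReal (J v) * φ (g.edist hg p (F v)).toReal
      ≤ ∫⁻ v in D, ENNReal.ofReal ((Real.sin ‖v‖ / ‖v‖) ^ k) * φ ‖v‖ :=
        setLIntegral_mono_ae' hDm hae
    _ ≤ ∫⁻ v in Metric.closedBall (0 : EuclideanSpace ℝ (Fin (k + 1))) Real.pi,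
          ENNReal.ofReal ((Real.sin ‖v‖ / ‖v‖) ^ k) * φ ‖v‖ := lintegral_mono_set hDπ
    _ = ENNReal.ofReal (unitSphereVolume k) *
          ∫⁻ r in Ioc (0:ℝ) Real.pi, ENNReal.ofReal (Real.sin r ^ k) * φ r :=
        lintegral_closedBall_sin_div_pow_mul k hφ

/-- **Volumes of distance shells under `Ric ≥ m - 1`**: on a compact connected Riemannian
`m`-manifold, `m ≥ 2`, with `Ric ≥ (m-1) g`, for `0 ≤ a ≤ b ≤ π` and every `p`,
`Vol{x | a < d(p, x) ≤ b} ≤ |S^{m-1}| ∫_a^b sin^{m-1}` (the model shell volume in `Sᵐ`;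
`lintegral_comp_edist_le_mul_lintegral_sin_pow` with `φ = 𝟙_{(a, b]}`).
[cite: Chavel2006, Thm. III.4.4 (III.4.21)] [cite: Colding1996Shape, §2] -/
theorem riemVolume_shell_le (hg : g.IsRiemannian) (hm : 2 ≤ m)
    (hRic : ∀ (x : M) (w : TangentSpace (𝓡 m) x), ((m : ℝ) - 1) * g.val x w w ≤ g.ricci x w w)
    (p : M) {a b : ℝ} (ha : 0 ≤ a) (hab : a ≤ b) (hb : b ≤ Real.pi) :
    g.riemVolume {x : M | (g.edist hg p x).toReal ∈ Ioc a b} ≤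
      ENNReal.ofReal (unitSphereVolume (m - 1) * ∫ t in a..b, Real.sin t ^ (m - 1)) := by
  have hmeas : MeasurableSet {x : M | (g.edist hg p x).toReal ∈ Ioc a b} := by
    have h1 : Continuous fun x : M ↦ g.edist hg p x :=
      (PseudoRiemannianMetric.continuous_edist hg).comp (Continuous.prodMk_right p)
    exact (ENNReal.measurable_toReal.comp h1.measurable) measurableSet_Ioc
  have key := lintegral_comp_edist_le_mul_lintegral_sin_pow g hg hm hRic p
    (measurable_one.indicator measurableSet_Ioc : Measurable ((Ioc a b).indicator (1 : ℝ → ℝ≥0∞)))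
  have hL : ∫⁻ x, (Ioc a b).indicator (1 : ℝ → ℝ≥0∞) (g.edist hg p x).toReal ∂g.riemVolume =
      g.riemVolume {x : M | (g.edist hg p x).toReal ∈ Ioc a b} := by
    rw [← lintegral_indicator_one hmeas]
    refine lintegral_congr fun x ↦ ?_
    simp only [Set.indicator, mem_setOf_eq, Pi.one_apply]
  have hR : ∫⁻ r in Ioc (0:ℝ) Real.pi, ENNReal.ofReal (Real.sin r ^ (m - 1)) *
      (Ioc a b).indicator (1 : ℝ → ℝ≥0∞) r =
      ENNReal.ofReal (∫ t in a..b, Real.sin t ^ (m - 1)) := by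
    have h1 : ∀ r : ℝ, ENNReal.ofReal (Real.sin r ^ (m - 1)) * (Ioc a b).indicator (1 : ℝ → ℝ≥0∞) r =
        (Ioc a b).indicator (fun r ↦ ENNReal.ofReal (Real.sin r ^ (m - 1))) r := by
      intro r
      by_cases hr : r ∈ Ioc a b
      · rw [indicator_of_mem hr, indicator_of_mem hr, Pi.one_apply, mul_one]
      · rw [indicator_of_notMem hr, indicator_of_notMem hr, mul_zero]
    simp_rw [h1]
    rw [setLIntegral_indicator measurableSet_Ioc]
    have hset : Ioc a b ∩ Ioc (0:ℝ) Real.pi = Ioc a b := by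
      ext r
      simp only [mem_inter_iff, mem_Ioc]
      constructor
      · rintro ⟨h, -⟩; exact h
      · rintro ⟨h1, h2⟩; exact ⟨⟨h1, h2⟩, ha.trans_lt h1, h2.trans hb⟩
    rw [hset, intervalIntegral.integral_of_le hab, ofReal_integral_eq_lintegral_ofReal]
    · exact ((Real.continuous_sin.pow (m - 1)).integrableOn_Icc (a := a) (b := b)).mono_set
        Ioc_subset_Icc_self
    · refine ae_restrict_of_forall_mem measurableSet_Ioc fun r hr ↦ ?_
      exact pow_nonneg (Real.sin_nonneg_of_nonneg_of_le_pi (ha.trans hr.1.le) (hr.2.trans hb)) _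
  rw [hL, hR, ← ENNReal.ofReal_mul (unitSphereVolume_pos _).le] at key
  exact key

/-- **Almost maximal volume: the law of `d_p` is `δ|Sᵐ|`-close to the spherical law, lower
bound.** On a compact connected Riemannian `m`-manifold, `m ≥ 2`, with `Ric ≥ (m-1) g` and
`Vol(M) ≥ (1 - δ)|Sᵐ|`, `δ ≥ 0`, for every `p` and every measurable `φ : ℝ → [0, 1]`,
  `|S^{m-1}| ∫_{(0,π]} sin^{m-1}(r) φ(r) dr ≤ ∫_M φ(d(p, x)) dVol(x) + δ |Sᵐ|`
(apply `lintegral_comp_edist_le_mul_lintegral_sin_pow` to `1 - φ` and use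
`|S^{m-1}| ∫₀^π sin^{m-1} = |Sᵐ|`). With the upper bound this says that for almost maximal volume
the distance function `d_p` is distributed, up to `δ|Sᵐ|` in total variation, like the distance
to a point of `Sᵐ` — at every `p`. [cite: Colding1996Shape, §2]
[cite: Colding1997Aspects, Thm. 2.2 (proof)] -/
theorem mul_lintegral_sin_pow_le_lintegral_comp_edist_add (hg : g.IsRiemannian) (hm : 2 ≤ m)
    (hRic : ∀ (x : M) (w : TangentSpace (𝓡 m) x), ((m : ℝ) - 1) * g.val x w w ≤ g.ricci x w w)
    {δ : ℝ} (hδ : 0 ≤ δ)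
    (hvol : ENNReal.ofReal ((1 - δ) * unitSphereVolume m) ≤ g.riemVolume (univ : Set M))
    (p : M) {φ : ℝ → ℝ≥0∞} (hφ : Measurable φ) (hφ1 : ∀ r, φ r ≤ 1) :
    ENNReal.ofReal (unitSphereVolume (m - 1)) *
        ∫⁻ r in Ioc (0:ℝ) Real.pi, ENNReal.ofReal (Real.sin r ^ (m - 1)) * φ r ≤
      ∫⁻ x, φ (g.edist hg p x).toReal ∂g.riemVolume + ENNReal.ofReal (δ * unitSphereVolume m) := by
  obtain ⟨k, rfl⟩ : ∃ k, m = k + 1 := ⟨m - 1, by omega⟩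
  rw [Nat.add_sub_cancel]
  set μ := g.riemVolume with hμ
  set ν : Measure ℝ := (volume.restrict (Ioc (0:ℝ) Real.pi)).withDensity
    (fun r ↦ ENNReal.ofReal (Real.sin r ^ k)) with hν
  have hdens : Measurable fun r : ℝ ↦ ENNReal.ofReal (Real.sin r ^ k) :=
    ENNReal.measurable_ofReal.comp (Real.continuous_sin.pow k).measurable
  -- rewrite the weighted integrals through `ν`
  have hνint : ∀ {ψ : ℝ → ℝ≥0∞}, Measurable ψ →
      ∫⁻ r in Ioc (0:ℝ) Real.pi, ENNReal.ofReal (Real.sin r ^ k) * ψ r = ∫⁻ r, ψ r ∂ν := by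
    intro ψ hψ
    rw [hν, lintegral_withDensity_eq_lintegral_mul _ hdens hψ]
    rfl
  -- total mass: `|Sᵏ| ν(ℝ) = |S^{k+1}|`
  have hνtot : ENNReal.ofReal (unitSphereVolume k) * ∫⁻ r, (1 : ℝ → ℝ≥0∞) r ∂ν =
      ENNReal.ofReal (unitSphereVolume (k + 1)) := by
    rw [← hνint measurable_one]
    simp only [Pi.one_apply, mul_one]
    rw [← ofReal_integral_eq_lintegral_ofReal, ← intervalIntegral.integral_of_le Real.pi_pos.le,
      ← ENNReal.ofReal_mul (unitSphereVolume_pos k).le,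
      ← unitSphereVolume_succ_eq_mul_integral_sin_pow k]
    · exact ((Real.continuous_sin.pow k).integrableOn_Icc (a := 0) (b := Real.pi)).mono_set
        Ioc_subset_Icc_self
    · refine ae_restrict_of_forall_mem measurableSet_Ioc fun r hr ↦ ?_
      exact pow_nonneg (Real.sin_nonneg_of_nonneg_of_le_pi hr.1.le hr.2) _
  -- the distance function and the complementary weight `1 - φ`
  have hdm : Measurable fun x : M ↦ (g.edist hg p x).toReal := by
    have h1 : Continuous fun x : M ↦ g.edist hg p x :=
      (PseudoRiemannianMetric.continuous_edist hg).comp (Continuous.prodMk_right p)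
    exact ENNReal.measurable_toReal.comp h1.measurable
  have hψ : Measurable fun r ↦ 1 - φ r := measurable_const.sub hφ
  have hsplitM : ∫⁻ x, φ (g.edist hg p x).toReal ∂μ + ∫⁻ x, (1 - φ (g.edist hg p x).toReal) ∂μ =
      μ univ := by
    have hm' : Measurable fun x ↦ φ (g.edist hg p x).toReal := hφ.comp hdm
    rw [← lintegral_add_left hm']
    have : (fun x ↦ φ (g.edist hg p x).toReal + (1 - φ (g.edist hg p x).toReal)) = fun _ ↦ 1 :=
      funext fun x ↦ add_tsub_cancel_of_le (hφ1 _)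
    rw [this, lintegral_const, one_mul]
  have hsplitν : ∫⁻ r, φ r ∂ν + ∫⁻ r, (1 - φ r) ∂ν = ∫⁻ r, (1 : ℝ → ℝ≥0∞) r ∂ν := by
    rw [← lintegral_add_left hφ]
    exact lintegral_congr fun r ↦ add_tsub_cancel_of_le (hφ1 r)
  -- the upper bound for `1 - φ`
  have hup := lintegral_comp_edist_le_mul_lintegral_sin_pow g hg hm hRic p hψ
  rw [Nat.add_sub_cancel, hνint hψ] at hup
  rw [hνint hφ]
  -- finiteness
  have hνφ_fin : ENNReal.ofReal (unitSphereVolume k) * ∫⁻ r, (1 - φ r) ∂ν ≠ ⊤ := by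
    refine ne_top_of_le_ne_top (b := ENNReal.ofReal (unitSphereVolume (k + 1)))
      ENNReal.ofReal_ne_top ?_
    rw [← hνtot]
    exact mul_le_mul_right (lintegral_mono fun r ↦ tsub_le_self) _
  -- the volume hypothesis: `|S^{k+1}| ≤ Vol(M) + δ|S^{k+1}|`
  have hvol' : ENNReal.ofReal (unitSphereVolume (k + 1)) ≤
      μ univ + ENNReal.ofReal (δ * unitSphereVolume (k + 1)) := by
    have hω := (unitSphereVolume_pos (k + 1)).le
    rcases le_or_gt δ 1 with hδ1 | hδ1
    · calc ENNReal.ofReal (unitSphereVolume (k + 1))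
          = ENNReal.ofReal ((1 - δ) * unitSphereVolume (k + 1)) +
              ENNReal.ofReal (δ * unitSphereVolume (k + 1)) := by
            rw [← ENNReal.ofReal_add (mul_nonneg (by linarith) hω) (mul_nonneg hδ hω)]
            congr 1; ring
        _ ≤ μ univ + ENNReal.ofReal (δ * unitSphereVolume (k + 1)) := add_le_add_left hvol _
    · calc ENNReal.ofReal (unitSphereVolume (k + 1))
          ≤ ENNReal.ofReal (δ * unitSphereVolume (k + 1)) :=
            ENNReal.ofReal_le_ofReal (by nlinarith)
        _ ≤ μ univ + ENNReal.ofReal (δ * unitSphereVolume (k + 1)) := le_add_self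
  -- assembly: `|Sᵏ|ν(φ) + |Sᵏ|ν(1-φ) = |S^{k+1}| ≤ μ(φ∘d) + μ((1-φ)∘d) + δ|S^{k+1}|`
  --           `≤ μ(φ∘d) + |Sᵏ|ν(1-φ) + δ|S^{k+1}|`, then cancel `|Sᵏ|ν(1-φ)`
  have hkey : ENNReal.ofReal (unitSphereVolume k) * ∫⁻ r, φ r ∂ν +
      ENNReal.ofReal (unitSphereVolume k) * ∫⁻ r, (1 - φ r) ∂ν ≤
      (∫⁻ x, φ (g.edist hg p x).toReal ∂μ + ENNReal.ofReal (δ * unitSphereVolume (k + 1))) +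
        ENNReal.ofReal (unitSphereVolume k) * ∫⁻ r, (1 - φ r) ∂ν :=
    calc ENNReal.ofReal (unitSphereVolume k) * ∫⁻ r, φ r ∂ν +
          ENNReal.ofReal (unitSphereVolume k) * ∫⁻ r, (1 - φ r) ∂ν
        = ENNReal.ofReal (unitSphereVolume (k + 1)) := by rw [← mul_add, hsplitν, hνtot]
      _ ≤ μ univ + ENNReal.ofReal (δ * unitSphereVolume (k + 1)) := hvol'
      _ = ∫⁻ x, φ (g.edist hg p x).toReal ∂μ + ∫⁻ x, (1 - φ (g.edist hg p x).toReal) ∂μ +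
            ENNReal.ofReal (δ * unitSphereVolume (k + 1)) := by rw [hsplitM]
      _ ≤ ∫⁻ x, φ (g.edist hg p x).toReal ∂μ +
            ENNReal.ofReal (unitSphereVolume k) * ∫⁻ r, (1 - φ r) ∂ν +
            ENNReal.ofReal (δ * unitSphereVolume (k + 1)) :=
          add_le_add_left (add_le_add_right hup _) _
      _ = (∫⁻ x, φ (g.edist hg p x).toReal ∂μ + ENNReal.ofReal (δ * unitSphereVolume (k + 1))) +
            ENNReal.ofReal (unitSphereVolume k) * ∫⁻ r, (1 - φ r) ∂ν := by ring
  exact (ENNReal.add_le_add_iff_right hνφ_fin).1 hkey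

/-- **Almost maximal volume: distance shells have almost the spherical volume, lower bound**:
under `Ric ≥ (m-1) g`, `m ≥ 2`, `Vol(M) ≥ (1-δ)|Sᵐ|`, `δ ≥ 0`, for `0 ≤ a ≤ b ≤ π` and every `p`,
`|S^{m-1}| ∫_a^b sin^{m-1} ≤ Vol{x | a < d(p, x) ≤ b} + δ|Sᵐ|`
(`mul_lintegral_sin_pow_le_lintegral_comp_edist_add` with `φ = 𝟙_{(a,b]}`). In particular every
point has points at distance in `(a, b]` as soon as `|S^{m-1}|∫_a^b sin^{m-1} > δ|Sᵐ|`.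
[cite: Colding1996Shape, §2] [cite: Colding1997Aspects, Thm. 2.2 (proof)] -/
theorem ofReal_mul_integral_sin_pow_le_riemVolume_shell_add (hg : g.IsRiemannian) (hm : 2 ≤ m)
    (hRic : ∀ (x : M) (w : TangentSpace (𝓡 m) x), ((m : ℝ) - 1) * g.val x w w ≤ g.ricci x w w)
    {δ : ℝ} (hδ : 0 ≤ δ)
    (hvol : ENNReal.ofReal ((1 - δ) * unitSphereVolume m) ≤ g.riemVolume (univ : Set M))
    (p : M) {a b : ℝ} (ha : 0 ≤ a) (hab : a ≤ b) (hb : b ≤ Real.pi) :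
    ENNReal.ofReal (unitSphereVolume (m - 1) * ∫ t in a..b, Real.sin t ^ (m - 1)) ≤
      g.riemVolume {x : M | (g.edist hg p x).toReal ∈ Ioc a b} +
        ENNReal.ofReal (δ * unitSphereVolume m) := by
  have hmeas : MeasurableSet {x : M | (g.edist hg p x).toReal ∈ Ioc a b} := by
    have h1 : Continuous fun x : M ↦ g.edist hg p x :=
      (PseudoRiemannianMetric.continuous_edist hg).comp (Continuous.prodMk_right p)
    exact (ENNReal.measurable_toReal.comp h1.measurable) measurableSet_Ioc
  have key := mul_lintegral_sin_pow_le_lintegral_comp_edist_add g hg hm hRic hδ hvol p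
    (measurable_one.indicator measurableSet_Ioc : Measurable ((Ioc a b).indicator (1 : ℝ → ℝ≥0∞)))
    (fun r ↦ by
      by_cases hr : r ∈ Ioc a b
      · rw [indicator_of_mem hr, Pi.one_apply]
      · rw [indicator_of_notMem hr]; exact zero_le_one)
  have hL : ∫⁻ x, (Ioc a b).indicator (1 : ℝ → ℝ≥0∞) (g.edist hg p x).toReal ∂g.riemVolume =
      g.riemVolume {x : M | (g.edist hg p x).toReal ∈ Ioc a b} := by
    rw [← lintegral_indicator_one hmeas]
    refine lintegral_congr fun x ↦ ?_
    simp only [Set.indicator, mem_setOf_eq, Pi.one_apply]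
  have hR : ∫⁻ r in Ioc (0:ℝ) Real.pi, ENNReal.ofReal (Real.sin r ^ (m - 1)) *
      (Ioc a b).indicator (1 : ℝ → ℝ≥0∞) r =
      ENNReal.ofReal (∫ t in a..b, Real.sin t ^ (m - 1)) := by
    have h1 : ∀ r : ℝ, ENNReal.ofReal (Real.sin r ^ (m - 1)) * (Ioc a b).indicator (1 : ℝ → ℝ≥0∞) r =
        (Ioc a b).indicator (fun r ↦ ENNReal.ofReal (Real.sin r ^ (m - 1))) r := by
      intro r
      by_cases hr : r ∈ Ioc a b
      · rw [indicator_of_mem hr, indicator_of_mem hr, Pi.one_apply, mul_one]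
      · rw [indicator_of_notMem hr, indicator_of_notMem hr, mul_zero]
    simp_rw [h1]
    rw [setLIntegral_indicator measurableSet_Ioc]
    have hset : Ioc a b ∩ Ioc (0:ℝ) Real.pi = Ioc a b := by
      ext r
      simp only [mem_inter_iff, mem_Ioc]
      constructor
      · rintro ⟨h, -⟩; exact h
      · rintro ⟨h1, h2⟩; exact ⟨⟨h1, h2⟩, ha.trans_lt h1, h2.trans hb⟩
    rw [hset, intervalIntegral.integral_of_le hab, ofReal_integral_eq_lintegral_ofReal]
    · exact ((Real.continuous_sin.pow (m - 1)).integrableOn_Icc (a := a) (b := b)).mono_set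
        Ioc_subset_Icc_self
    · refine ae_restrict_of_forall_mem measurableSet_Ioc fun r hr ↦ ?_
      exact pow_nonneg (Real.sin_nonneg_of_nonneg_of_le_pi (ha.trans hr.1.le) (hr.2.trans hb)) _
  rw [hL, hR, ← ENNReal.ofReal_mul (unitSphereVolume_pos _).le] at key
  exact key

end Main

/-! ### §3 The estimates in the binders of `Colding1996_volume_ghClose` -/

section FactVocabulary

open Literature.Geometry.Lorentzian (riemannianMeasure)

/-- **The law of `d_p` is dominated by the spherical law, in the binders of
`Colding1996_volume_ghClose`**: on a closed connected Riemannian `n`-manifold `(M, h)`, `n ≥ 2`,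
with `Ric ≥ (n-1) h`, for every `p` and measurable `φ : ℝ → [0, ∞]`,
`∫_M φ(d(p, x)) dμ_h(x) ≤ |S^{n-1}| ∫_{(0,π]} sin^{n-1}(r) φ(r) dr`
(`lintegral_comp_edist_le_mul_lintegral_sin_pow` for `g = ofRiemannian h`).
[cite: Chavel2006, Thm. III.4.4 (III.4.21)] [cite: Colding1996Shape, §2] -/
theorem lintegral_comp_riemannianEDist_le_mul_lintegral_sin_pow (n : ℕ) (hn : 2 ≤ n)
    (M : Type) [TopologicalSpace M] [T2Space M] [SecondCountableTopology M]
    [ChartedSpace (EuclideanSpace ℝ (Fin n)) M] [IsManifold (𝓡 n) ∞ M] [CompactSpace M]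
    [ConnectedSpace M] [MeasurableSpace M] [BorelSpace M]
    (h : Bundle.ContMDiffRiemannianMetric (𝓡 n) ∞ (EuclideanSpace ℝ (Fin n))
      (TangentSpace (𝓡 n) : M → Type _))
    [(PseudoRiemannianMetric.ofRiemannian h).HasLeviCivita]
    (hRic : ∀ (x : M) (v : TangentSpace (𝓡 n) x),
      ((n : ℝ) - 1) * h.inner x v v ≤ (PseudoRiemannianMetric.ofRiemannian h).ricci x v v)
    (p : M) {φ : ℝ → ℝ≥0∞} (hφ : Measurable φ) :
    ∫⁻ x, φ (letI : Bundle.RiemannianBundle (fun x : M ↦ TangentSpace (𝓡 n) x) :=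
        ⟨h.toContinuousRiemannianMetric.toRiemannianMetric⟩
      Manifold.riemannianEDist (𝓡 n) p x).toReal ∂riemannianMeasure h ≤
      ENNReal.ofReal (unitSphereVolume (n - 1)) *
        ∫⁻ r in Ioc (0:ℝ) Real.pi, ENNReal.ofReal (Real.sin r ^ (n - 1)) * φ r := by
  haveI : LocallyCompactSpace M := Manifold.locallyCompact_of_finiteDimensional (𝓡 n)
  haveI : T3Space M := inferInstance
  set g := PseudoRiemannianMetric.ofRiemannian h with hg_def
  have hg : g.IsRiemannian := PseudoRiemannianMetric.isRiemannian_ofRiemannian h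
  have key := lintegral_comp_edist_le_mul_lintegral_sin_pow g hg hn (fun x v ↦ hRic x v) p hφ
  rw [PseudoRiemannianMetric.riemVolume_eq hg] at key
  exact key

/-- **Almost maximal volume: the law of `d_p` is `δ|Sⁿ|`-close to the spherical law, in the
binders of `Colding1996_volume_ghClose`**: on a closed connected Riemannian `n`-manifold `(M, h)`,
`n ≥ 2`, with `Ric ≥ (n-1) h` and `μ_h(M) ≥ (1-δ)|Sⁿ|`, `δ ≥ 0`, for every `p` and measurable
`φ : ℝ → [0, 1]`,
`|S^{n-1}| ∫_{(0,π]} sin^{n-1}(r) φ(r) dr ≤ ∫_M φ(d(p, x)) dμ_h(x) + δ|Sⁿ|`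
(`mul_lintegral_sin_pow_le_lintegral_comp_edist_add` for `g = ofRiemannian h`).
[cite: Colding1996Shape, §2] [cite: Colding1997Aspects, Thm. 2.2 (proof)] -/
theorem mul_lintegral_sin_pow_le_lintegral_comp_riemannianEDist_add (n : ℕ) (hn : 2 ≤ n)
    (M : Type) [TopologicalSpace M] [T2Space M] [SecondCountableTopology M]
    [ChartedSpace (EuclideanSpace ℝ (Fin n)) M] [IsManifold (𝓡 n) ∞ M] [CompactSpace M]
    [ConnectedSpace M] [MeasurableSpace M] [BorelSpace M]
    (h : Bundle.ContMDiffRiemannianMetric (𝓡 n) ∞ (EuclideanSpace ℝ (Fin n))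
      (TangentSpace (𝓡 n) : M → Type _))
    [(PseudoRiemannianMetric.ofRiemannian h).HasLeviCivita]
    (hRic : ∀ (x : M) (v : TangentSpace (𝓡 n) x),
      ((n : ℝ) - 1) * h.inner x v v ≤ (PseudoRiemannianMetric.ofRiemannian h).ricci x v v)
    {δ : ℝ} (hδ : 0 ≤ δ)
    (hvol : ENNReal.ofReal ((1 - δ) * unitSphereVolume n) ≤ riemannianMeasure h Set.univ)
    (p : M) {φ : ℝ → ℝ≥0∞} (hφ : Measurable φ) (hφ1 : ∀ r, φ r ≤ 1) :
    ENNReal.ofReal (unitSphereVolume (n - 1)) *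
        ∫⁻ r in Ioc (0:ℝ) Real.pi, ENNReal.ofReal (Real.sin r ^ (n - 1)) * φ r ≤
      ∫⁻ x, φ (letI : Bundle.RiemannianBundle (fun x : M ↦ TangentSpace (𝓡 n) x) :=
          ⟨h.toContinuousRiemannianMetric.toRiemannianMetric⟩
        Manifold.riemannianEDist (𝓡 n) p x).toReal ∂riemannianMeasure h +
        ENNReal.ofReal (δ * unitSphereVolume n) := by
  haveI : LocallyCompactSpace M := Manifold.locallyCompact_of_finiteDimensional (𝓡 n)
  haveI : T3Space M := inferInstance
  set g := PseudoRiemannianMetric.ofRiemannian h with hg_def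
  have hg : g.IsRiemannian := PseudoRiemannianMetric.isRiemannian_ofRiemannian h
  have hvol' : ENNReal.ofReal ((1 - δ) * unitSphereVolume n) ≤ g.riemVolume (univ : Set M) := by
    rw [PseudoRiemannianMetric.riemVolume_eq hg]
    exact hvol
  have key := mul_lintegral_sin_pow_le_lintegral_comp_edist_add g hg hn (fun x v ↦ hRic x v) hδ
    hvol' p hφ hφ1
  rw [PseudoRiemannianMetric.riemVolume_eq hg] at key
  exact key

end FactVocabulary

end Literature.Geometry.Riemannian

end
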